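import Literature.NumberTheory.QuadraticFields.ClassNumberLeSqrtMulLog
import Literature.NumberTheory.QuadraticFields.ClassNumberLeAbs
import Literature.NumberTheory.QuadraticFields.ImaginaryQuadraticClassNumberValues
import Literature.NumberTheory.EllipticCurves.HeegnerPointsImaginaryQuadraticProofs
import HarnessLib

set_option linter.dupNamespace false -- `Summit.BirchSwinnertonDyer.BirchSwinnertonDyer.Theorems.…` (summit = sub)
set_option autoImplicit false

/-!
# Crux `HeegnerTwistCouplingInSupply` (stmt-BirchSwinnertonDyer-21381), line `size-tail`: SHARP size levers
# — `p ∤ h(K′)` free by SIZE at class-number-formula strength and by kernel tables — PROVED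

Route `BiquadraticEisensteinDescent` (cell `pub/bsd-wall`, row 12; width seat `bsd-wall-cm-bed-w2` g5, 2026-08-28).
Helper file for the line `size-tail` of crux stmt-BirchSwinnertonDyer-21381 (skeleton of record
`Cruxes/HeegnerTwistCouplingInSupply/Lines/size_tail.lean`, lead `bsd-line-ibd-p1`). The landed first stub
`…HeegnerTwistCouplingInSupplySizeIndivisible.stub_sizeIndivisible` (p595406) frees the conjunct `p ∤ h(K′)` of the
crux below the MINKOWSKI threshold `121·|d_K′| < p` (empty for every `p < 850`, in particular at the CORE primes
`p ∈ {5, 7}` of the CM inert-bad corner). The line card (`Lines/size-tail.md`, «typer follow-up») asks for the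
class-number-formula strength. This file supplies it, with NO new definition and NO named fact — every ingredient
is already a tree theorem:

* §1 `not_dvd_classNumber_of_sqrt_mul_log_lt` / `stub_sizeIndivisible_sqrtLog` — **`π⁻¹·√|d_K′|·log|d_K′| < p ⇒
  p ∤ h(K′)`** for `|d_K′| > 4`, from Oesterlé's PROVED bound `h_K ≤ π⁻¹ √|d_K| log|d_K|`
  (`Literature.NumberTheory.QuadraticFields.Quadratic.classNumber_le_sqrt_mul_log`, Enseign. Math. 34 (1988) II §3
  (27), proved in the tree from the class number formula and `|L(1,χ)| ≤ log d`);
* §2 `not_dvd_classNumber_of_natAbs_discr_lt` / `stub_sizeIndivisible_linear` — **`|d_K′| < p ⇒ p ∤ h(K′)`**, from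
  the forms bound `h(D) ≤ |D|` (`BinaryQuadraticForm.classNumber_le_natAbs`, Lenstra–Pomerance (2.3)) and
  `h(d_K) = h_K` (`Quadratic.card_reducedForms_eq_classNumber`, Cox Thm. 7.7(ii)) — already `121×` wider than the
  landed lever, with an integer threshold;
* §3 kernel TABLE levers for the core primes — **`|d_K′| ≤ 46 ⇒ h(K′) ≤ 4`** (so `p ∤ h(K′)` for every `p ≥ 5`) and
  **`|d_K′| ≤ 70 ⇒ h(K′) ≤ 6`** (every `p ≥ 7`), decided by the kernel on the computable form class number
  `Quadratic.BinQF.classNumber D = #reducedFormsList D` over ALL `D` in the range (`decide +kernel`, cost `Σ|D|`),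
  read on the field side through `ClassNumberValues.classNumber_eq_of_discr_eq` (Cox Thm. 2.13 + Thm. 7.7(ii));
  likewise **`|d_K′| ≤ 166 ⇒ h(K′) ≤ 10`** (`p ≥ 11`) and **`|d_K′| ≤ 190 ⇒ h(K′) ≤ 12`** (`p ≥ 13`). All four tables
  are sharp: `h(−47) = 5`, `h(−71) = 7`, `h(−167) = 11`, `h(−191) = 13`; beyond `p = 13` the §1 lever takes over;
* §4 `stub_sizeIndivisible_oneStop` — the disjunction of all the above thresholds as ONE hypothesis (appendix for a
  skeleton v3: case-split on the disjunction; its negation is the tail stub's extra hypothesis).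

Effect on the frame `size_tail`: with §1 (or §3 at `p ∈ {5, 7}`) in place of `121·|d| < p` the SIZE branch of the
BULK/TAIL split is non-empty at the core primes (`p = 5`: Heegner `K′` with `|d_K′| ≤ 46`; `p = 7`: `|d_K′| ≤ 70`),
and the tail stub's vanishing hypothesis strengthens accordingly — a reshape that is the line LEAD's call; this
file changes no skeleton. Single Heegner fields are certified exactly by
`ClassNumberValues.not_dvd_classNumber_of_discr_eq` (one kernel value `h(D)` per field).

THEOREMS ONLY; imports no `Theses` module; nothing about the tail coupling or any case of BSD is asserted — BSD is
not proved by any of this. Supports stmt-BirchSwinnertonDyer-21381.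
-/

noncomputable section

open scoped NumberField

open NumberField Literature.NumberTheory.EllipticCurves Literature.NumberTheory.QuadraticFields

namespace Summit.BirchSwinnertonDyer.BirchSwinnertonDyer.Theorems.BiquadraticEisensteinDescentHeegnerTwistCouplingInSupplySizeIndivisibleSharp

/-! ## §0. Bookkeeping on an imaginary quadratic field -/

section Bookkeeping

variable {K : Type*} [Field K] [NumberField K]

/-- `|d_K|` as a real number is the cast of `Int.natAbs d_K`. [folklore] -/
theorem natCast_natAbs_discr (K : Type*) [Field K] [NumberField K] :
    (((NumberField.discr K).natAbs : ℕ) : ℝ) = |(NumberField.discr K : ℝ)| := by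
  rw [Nat.cast_natAbs, Int.cast_abs]

/-- On an imaginary quadratic field, `4 < |d_K|` is `d_K < −4`. [folklore] -/
theorem discr_lt_neg_four (hK : IsImaginaryQuadratic K) (h4 : 4 < (NumberField.discr K).natAbs) :
    NumberField.discr K < -4 := by
  have hneg : NumberField.discr K < 0 := hK.discr_neg
  omega

/-- **`h_K = h(d_K)`** with the kernel-computable form class number `Quadratic.BinQF.classNumber` (Cox Thm. 2.13 +
Thm. 7.7(ii), the tree's `ClassNumberValues.classNumber_eq_of_discr_eq`). [cite: Cox2013, §7.B Thm. 7.7(ii)] -/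
theorem classNumber_eq_binQF_classNumber (hK : IsImaginaryQuadratic K) :
    NumberField.classNumber K = Quadratic.BinQF.classNumber (NumberField.discr K) :=
  ClassNumberValues.classNumber_eq_of_discr_eq hK.1 rfl hK.discr_neg rfl

/-- `0 < h_K < p ⇒ p ∤ h_K`. [folklore] -/
theorem not_dvd_classNumber_of_lt {p : ℕ} (hlt : NumberField.classNumber K < p) :
    ¬ p ∣ NumberField.classNumber K :=
  Nat.not_dvd_of_pos_of_lt Fintype.card_pos hlt

end Bookkeeping

/-! ## §1. Class-number-formula strength: `π⁻¹ √|d| log|d| < p ⇒ p ∤ h` (Oesterlé 1988 (27), proved in the tree) -/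

section ClassNumberFormula

variable {K : Type*} [Field K] [NumberField K]

/-- **`h_K < p` below the class-number-formula threshold.** For an imaginary quadratic field `K` with `|d_K| > 4`
and a natural number `p` with `π⁻¹·√|d_K|·log|d_K| < p`: `h_K < p`. Proof: Oesterlé's bound
`h_K ≤ π⁻¹ √|d_K| log|d_K|` (`Quadratic.classNumber_le_sqrt_mul_log`, class number formula `L(1,χ_K) = π h_K/√|d_K|`
for `d_K < −4` and `|L(1,χ_K)| ≤ log|d_K|`). [cite: Oesterle1988Gauss, II §3 Proposition p. 57 (27)] -/
theorem classNumber_lt_of_sqrt_mul_log_lt (hK : IsImaginaryQuadratic K) (h4 : 4 < (NumberField.discr K).natAbs)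
    {p : ℕ} (hlt : Real.pi⁻¹ * Real.sqrt ((NumberField.discr K).natAbs : ℝ) *
      Real.log ((NumberField.discr K).natAbs : ℝ) < p) :
    NumberField.classNumber K < p := by
  have hle := Quadratic.classNumber_le_sqrt_mul_log hK.1 (discr_lt_neg_four hK h4)
  rw [← natCast_natAbs_discr K] at hle
  exact_mod_cast hle.trans_lt hlt

/-- **Size lever at class-number-formula strength: `π⁻¹·√|d_K|·log|d_K| < p ⇒ p ∤ h_K`** for an imaginary quadratic
`K` with `|d_K| > 4` (`1 ≤ h_K < p`). [cite: Oesterle1988Gauss, II §3 Proposition p. 57 (27)] -/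
theorem not_dvd_classNumber_of_sqrt_mul_log_lt (hK : IsImaginaryQuadratic K)
    (h4 : 4 < (NumberField.discr K).natAbs) {p : ℕ}
    (hlt : Real.pi⁻¹ * Real.sqrt ((NumberField.discr K).natAbs : ℝ) *
      Real.log ((NumberField.discr K).natAbs : ℝ) < p) :
    ¬ p ∣ NumberField.classNumber K :=
  not_dvd_classNumber_of_lt (classNumber_lt_of_sqrt_mul_log_lt hK h4 hlt)

/-- **Sufficient √-form without `π` or `log` constants mixed: `√|d_K|·log|d_K| < π·p ⇒ p ∤ h_K`** (the same lever,
multiplied through by `π > 0`). [cite: Oesterle1988Gauss, II §3 Proposition p. 57 (27)] -/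
theorem not_dvd_classNumber_of_sqrt_mul_log_lt_pi_mul (hK : IsImaginaryQuadratic K)
    (h4 : 4 < (NumberField.discr K).natAbs) {p : ℕ}
    (hlt : Real.sqrt ((NumberField.discr K).natAbs : ℝ) * Real.log ((NumberField.discr K).natAbs : ℝ) <
      Real.pi * p) :
    ¬ p ∣ NumberField.classNumber K := by
  refine not_dvd_classNumber_of_sqrt_mul_log_lt hK h4 ?_
  have hπ := Real.pi_pos
  rw [mul_assoc, inv_mul_lt_iff₀ hπ]
  exact hlt

/-- **Stub-shaped form (binders of the registered `stub_sizeIndivisible`, threshold replaced): for a prime `p` and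
an imaginary quadratic field `K′` with `4 < |d_K′|` and `π⁻¹·√|d_K′|·log|d_K′| < p`, `p ∤ h(K′)`.** This is the
class-number-formula size lever the line card `Lines/size-tail.md` asks for («print strength `|d| ≲ p²/log²p`»);
the crux's own binder `4 < |d_K′|` is exactly Oesterlé's `d > 4`. [cite: Oesterle1988Gauss, II §3 Proposition p. 57 (27)] -/
theorem stub_sizeIndivisible_sqrtLog :
    ∀ (p : ℕ) [Fact p.Prime] (K : Type) [Field K] [NumberField K],
      IsImaginaryQuadratic K → 4 < (NumberField.discr K).natAbs →
        Real.pi⁻¹ * Real.sqrt ((NumberField.discr K).natAbs : ℝ) * Real.log ((NumberField.discr K).natAbs : ℝ) < p →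
          ¬ p ∣ NumberField.classNumber K := by
  intro p _ K _ _ hK h4 hlt
  exact not_dvd_classNumber_of_sqrt_mul_log_lt hK h4 hlt

end ClassNumberFormula

/-! ## §2. Linear integer threshold: `|d| < p ⇒ p ∤ h` (forms bound `h(D) ≤ |D|`, proved in the tree) -/

section Linear

variable {K : Type*} [Field K] [NumberField K]

/-- **`h_K ≤ |d_K|`** for an imaginary quadratic field: `h_K = h(d_K)` (reduced forms, Cox Thm. 7.7(ii)) and
`h(D) ≤ |D|` (`BinaryQuadraticForm.classNumber_le_natAbs`). [cite: LenstraPomerance1992, §2 (2.3)] -/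
theorem classNumber_le_natAbs_discr (hK : IsImaginaryQuadratic K) :
    NumberField.classNumber K ≤ (NumberField.discr K).natAbs := by
  rw [← Quadratic.card_reducedForms_eq_classNumber hK.1 hK.discr_neg]
  exact BinaryQuadraticForm.classNumber_le_natAbs hK.discr_neg

/-- **Linear size lever: `|d_K| < p ⇒ p ∤ h_K`** (`1 ≤ h_K ≤ |d_K| < p`). [cite: LenstraPomerance1992, §2 (2.3)] -/
theorem not_dvd_classNumber_of_natAbs_discr_lt (hK : IsImaginaryQuadratic K) {p : ℕ}
    (hlt : (NumberField.discr K).natAbs < p) : ¬ p ∣ NumberField.classNumber K :=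
  not_dvd_classNumber_of_lt ((classNumber_le_natAbs_discr hK).trans_lt hlt)

/-- **Stub-shaped linear form: for a prime `p` and an imaginary quadratic `K′` with `|d_K′| < p`, `p ∤ h(K′)`** — the
registered `stub_sizeIndivisible` with its threshold `121·|d_K′| < p` widened `121`-fold, still an integer test.
[cite: LenstraPomerance1992, §2 (2.3)] -/
theorem stub_sizeIndivisible_linear :
    ∀ (p : ℕ) [Fact p.Prime] (K : Type) [Field K] [NumberField K],
      IsImaginaryQuadratic K → (NumberField.discr K).natAbs < p → ¬ p ∣ NumberField.classNumber K := by
  intro p _ K _ _ hK hlt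
  exact not_dvd_classNumber_of_natAbs_discr_lt hK hlt

-- (The landed Minkowski lever `…SizeIndivisible.stub_sizeIndivisible`, threshold `121·|d| < p`, is the special case
-- `121·|d| < p ⇒ |d| < p` of `stub_sizeIndivisible_linear`; it is not restated here.)

end Linear

/-! ## §3. Kernel tables for the core primes `p = 5, 7`: `|d| ≤ 46 ⇒ h ≤ 4`, `|d| ≤ 70 ⇒ h ≤ 6` -/

section Tables

/-- **`h(D) ≤ 4` for every `−46 ≤ D < 0`** (form class number `Quadratic.BinQF.classNumber`, all `D` in the range,
discriminants or not; sharp: `h(−39) = 4`, and `h(−47) = 5` is the first value `≥ 5`). Kernel-decided.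
[cite: Cox2013, §2.A Thm. 2.13] -/
theorem binQF_classNumber_le_four_of_le :
    ∀ D : ℤ, -46 ≤ D → D < 0 → Quadratic.BinQF.classNumber D ≤ 4 := by
  decide +kernel

/-- **`h(D) ≤ 6` for every `−70 ≤ D < 0`** (sharp: `h(−71) = 7` is the first value `≥ 7`). Kernel-decided.
[cite: Cox2013, §2.A Thm. 2.13] -/
theorem binQF_classNumber_le_six_of_le :
    ∀ D : ℤ, -70 ≤ D → D < 0 → Quadratic.BinQF.classNumber D ≤ 6 := by
  decide +kernel

/-- **`h(D) ≤ 10` for every `−166 ≤ D < 0`** (sharp: `h(−167) = 11` is the first value `≥ 11`). Kernel-decided.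
[cite: Cox2013, §2.A Thm. 2.13] -/
theorem binQF_classNumber_le_ten_of_le :
    ∀ D : ℤ, -166 ≤ D → D < 0 → Quadratic.BinQF.classNumber D ≤ 10 := by
  decide +kernel

/-- **`h(D) ≤ 12` for every `−190 ≤ D < 0`** (sharp: `h(−191) = 13` is the first value `≥ 13`). Kernel-decided.
[cite: Cox2013, §2.A Thm. 2.13] -/
theorem binQF_classNumber_le_twelve_of_le :
    ∀ D : ℤ, -190 ≤ D → D < 0 → Quadratic.BinQF.classNumber D ≤ 12 := by
  decide +kernel

variable {K : Type*} [Field K] [NumberField K]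

/-- **`|d_K| ≤ 46 ⇒ h_K ≤ 4`** for an imaginary quadratic field. [cite: Cox2013, §7.B Thm. 7.7(ii)] -/
theorem classNumber_le_four_of_natAbs_discr_le (hK : IsImaginaryQuadratic K)
    (h46 : (NumberField.discr K).natAbs ≤ 46) : NumberField.classNumber K ≤ 4 := by
  rw [classNumber_eq_binQF_classNumber hK]
  have hneg : NumberField.discr K < 0 := hK.discr_neg
  exact binQF_classNumber_le_four_of_le _ (by omega) hneg

/-- **`|d_K| ≤ 70 ⇒ h_K ≤ 6`** for an imaginary quadratic field. [cite: Cox2013, §7.B Thm. 7.7(ii)] -/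
theorem classNumber_le_six_of_natAbs_discr_le (hK : IsImaginaryQuadratic K)
    (h70 : (NumberField.discr K).natAbs ≤ 70) : NumberField.classNumber K ≤ 6 := by
  rw [classNumber_eq_binQF_classNumber hK]
  have hneg : NumberField.discr K < 0 := hK.discr_neg
  exact binQF_classNumber_le_six_of_le _ (by omega) hneg

/-- **`|d_K| ≤ 166 ⇒ h_K ≤ 10`** for an imaginary quadratic field. [cite: Cox2013, §7.B Thm. 7.7(ii)] -/
theorem classNumber_le_ten_of_natAbs_discr_le (hK : IsImaginaryQuadratic K)
    (h166 : (NumberField.discr K).natAbs ≤ 166) : NumberField.classNumber K ≤ 10 := by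
  rw [classNumber_eq_binQF_classNumber hK]
  have hneg : NumberField.discr K < 0 := hK.discr_neg
  exact binQF_classNumber_le_ten_of_le _ (by omega) hneg

/-- **`|d_K| ≤ 190 ⇒ h_K ≤ 12`** for an imaginary quadratic field. [cite: Cox2013, §7.B Thm. 7.7(ii)] -/
theorem classNumber_le_twelve_of_natAbs_discr_le (hK : IsImaginaryQuadratic K)
    (h190 : (NumberField.discr K).natAbs ≤ 190) : NumberField.classNumber K ≤ 12 := by
  rw [classNumber_eq_binQF_classNumber hK]
  have hneg : NumberField.discr K < 0 := hK.discr_neg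
  exact binQF_classNumber_le_twelve_of_le _ (by omega) hneg

/-- **Core-prime table lever at `p ≥ 5`: `|d_K′| ≤ 46 ⇒ p ∤ h(K′)`** (`h(K′) ≤ 4 < 5 ≤ p`). At `p = 5` this puts every
Heegner field of discriminant `−7, −8, −11, …, −43` (resp. all `|d| ≤ 46`) in the SIZE branch of `size_tail`.
[cite: Cox2013, §7.B Thm. 7.7(ii)] -/
theorem stub_sizeIndivisible_table_five :
    ∀ (p : ℕ) [Fact p.Prime] (K : Type) [Field K] [NumberField K],
      IsImaginaryQuadratic K → 5 ≤ p → (NumberField.discr K).natAbs ≤ 46 → ¬ p ∣ NumberField.classNumber K := by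
  intro p _ K _ _ hK hp h46
  exact not_dvd_classNumber_of_lt ((classNumber_le_four_of_natAbs_discr_le hK h46).trans_lt (by omega))

/-- **Core-prime table lever at `p ≥ 7`: `|d_K′| ≤ 70 ⇒ p ∤ h(K′)`** (`h(K′) ≤ 6 < 7 ≤ p`).
[cite: Cox2013, §7.B Thm. 7.7(ii)] -/
theorem stub_sizeIndivisible_table_seven :
    ∀ (p : ℕ) [Fact p.Prime] (K : Type) [Field K] [NumberField K],
      IsImaginaryQuadratic K → 7 ≤ p → (NumberField.discr K).natAbs ≤ 70 → ¬ p ∣ NumberField.classNumber K := by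
  intro p _ K _ _ hK hp h70
  exact not_dvd_classNumber_of_lt ((classNumber_le_six_of_natAbs_discr_le hK h70).trans_lt (by omega))

/-- **Table lever at `p ≥ 11`: `|d_K′| ≤ 166 ⇒ p ∤ h(K′)`** (`h(K′) ≤ 10 < 11 ≤ p`).
[cite: Cox2013, §7.B Thm. 7.7(ii)] -/
theorem stub_sizeIndivisible_table_eleven :
    ∀ (p : ℕ) [Fact p.Prime] (K : Type) [Field K] [NumberField K],
      IsImaginaryQuadratic K → 11 ≤ p → (NumberField.discr K).natAbs ≤ 166 → ¬ p ∣ NumberField.classNumber K := by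
  intro p _ K _ _ hK hp h166
  exact not_dvd_classNumber_of_lt ((classNumber_le_ten_of_natAbs_discr_le hK h166).trans_lt (by omega))

/-- **Table lever at `p ≥ 13`: `|d_K′| ≤ 190 ⇒ p ∤ h(K′)`** (`h(K′) ≤ 12 < 13 ≤ p`).
[cite: Cox2013, §7.B Thm. 7.7(ii)] -/
theorem stub_sizeIndivisible_table_thirteen :
    ∀ (p : ℕ) [Fact p.Prime] (K : Type) [Field K] [NumberField K],
      IsImaginaryQuadratic K → 13 ≤ p → (NumberField.discr K).natAbs ≤ 190 → ¬ p ∣ NumberField.classNumber K := by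
  intro p _ K _ _ hK hp h190
  exact not_dvd_classNumber_of_lt ((classNumber_le_twelve_of_natAbs_discr_le hK h190).trans_lt (by omega))

end Tables

/-! ## §4. One-stop size lever for the skeleton: any of the thresholds of §§1–3 frees `p ∤ h(K′)` -/

section OneStop

/-- **One-stop SIZE lever (appendix for the line lead).** For a prime `p` and an imaginary quadratic `K′` with
`4 < |d_K′|`, `p ∤ h(K′)` holds as soon as ANY of the proved thresholds is met: the linear one `|d_K′| < p` (§2),
the class-number-formula one `π⁻¹·√|d_K′|·log|d_K′| < p` (§1), or one of the four kernel tables `p ≥ 5 ∧ |d_K′| ≤ 46`,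
`p ≥ 7 ∧ |d_K′| ≤ 70`, `p ≥ 11 ∧ |d_K′| ≤ 166`, `p ≥ 13 ∧ |d_K′| ≤ 190` (§3). A skeleton `size_tail` v3 can case-split
on this single disjunction (its negation is then the tail stub's extra hypothesis) without choosing among the
levers; no definition is introduced (the disjunction is spelled out). [cite: Oesterle1988Gauss, II §3 Proposition p. 57 (27)]
[cite: LenstraPomerance1992, §2 (2.3)] [cite: Cox2013, §7.B Thm. 7.7(ii)] -/
theorem stub_sizeIndivisible_oneStop :
    ∀ (p : ℕ) [Fact p.Prime] (K : Type) [Field K] [NumberField K],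
      IsImaginaryQuadratic K → 4 < (NumberField.discr K).natAbs →
        ((NumberField.discr K).natAbs < p ∨
          Real.pi⁻¹ * Real.sqrt ((NumberField.discr K).natAbs : ℝ) * Real.log ((NumberField.discr K).natAbs : ℝ) < p ∨
          (5 ≤ p ∧ (NumberField.discr K).natAbs ≤ 46) ∨ (7 ≤ p ∧ (NumberField.discr K).natAbs ≤ 70) ∨
          (11 ≤ p ∧ (NumberField.discr K).natAbs ≤ 166) ∨ (13 ≤ p ∧ (NumberField.discr K).natAbs ≤ 190)) →
        ¬ p ∣ NumberField.classNumber K := by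
  intro p _ K _ _ hK h4 h
  rcases h with hlin | hcnf | ⟨hp, hd⟩ | ⟨hp, hd⟩ | ⟨hp, hd⟩ | ⟨hp, hd⟩
  · exact not_dvd_classNumber_of_natAbs_discr_lt hK hlin
  · exact not_dvd_classNumber_of_sqrt_mul_log_lt hK h4 hcnf
  · exact stub_sizeIndivisible_table_five p K hK hp hd
  · exact stub_sizeIndivisible_table_seven p K hK hp hd
  · exact stub_sizeIndivisible_table_eleven p K hK hp hd
  · exact stub_sizeIndivisible_table_thirteen p K hK hp hd

end OneStop

end Summit.BirchSwinnertonDyer.BirchSwinnertonDyer.Theorems.BiquadraticEisensteinDescentHeegnerTwistCouplingInSupplySizeIndivisibleSharp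

end
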